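import Summits.Langlands.Langlands.Theses.PhantomRMYoshida

/-!
# Route PhantomRMYoshida — `PhantomRMJunction` (stmt-Langlands-13643): logical position

`PhantomRMJunction := ∀ _ : PhantomRMSector, Langlands` (definitionally the arrow
`PhantomRMSector → Langlands`) is the route's JUNCTION: the complement of the sector
`PhantomRMSector` (a weak-Satake sector of conjunct (B) `GaloisToAutomorphic 4` over `ℚ`) inside the
summit `Langlands` (reciprocity for `GL_n` over every number field, both directions, all places). It
is the fourth hypothesis of the deciding theorem
`Theses.PhantomRMYoshida.closes : SerreKWAutomorphicGL2 → StableYoshidaCongruence →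
ResiduallyYoshidaLifting → PhantomRMJunction → Langlands`, filed only so that `closes` ends in the
summit constant by name ("not this route's business; true iff Langlands").

This file does NOT assert the item (nor its negation), and deliberately contains no theorem whose
conclusion is the item or `¬ Langlands` under hypotheses (so that no audit credits a conditional
arrow such as `Langlands → PhantomRMJunction` as progress on the item). It records, kernel-checked
and in `↔` form, exactly where the item sits, so that its status `open-problem` is a theorem-shaped
fact rather than a remark (same bookkeeping as `Theorems/SkinnerWilesDefectOneSectorComplement.lean`
for the sibling sector route):

* `phantomRMJunction_iff_imp`: the `∀ _ :` spelling is the arrow (`Iff.rfl`);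
* `phantomRMJunction_iff_not_or`: truth table `PhantomRMJunction ↔ ¬ PhantomRMSector ∨ Langlands` —
  the item is PROVABLE only by proving the summit or by refuting the route target (a counterexample
  to `GSp₄` reciprocity in the residually-Yoshida ordinary weight-`(2,2)` sector over `ℚ`);
* `phantomRMJunction_iff_of_target`: under the route target, `PhantomRMJunction ↔ Langlands`;
* `phantomRMJunction_iff_of_cruxes`: under the three cruxes of `closes`,
  `PhantomRMJunction ↔ Langlands` — once the route's own cruxes land, this item IS the summit;
* `not_phantomRMJunction_iff`: `¬ PhantomRMJunction ↔ PhantomRMSector ∧ ¬ Langlands` — a refutation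
  must PROVE the (open) sector AND disprove the formal summit;
* `phantomRMJunction_localLanglandsDebt`: junction + target give a local Langlands datum for the
  general linear groups over `F_v` at every finite place `v` of every number field `F` (the `llc`
  field of the reciprocity data `𝓡` the summit asserts to exist) — Harris–Taylor/Henniart content,
  the named fact `LocalLanglandsDatum.nonempty`, far outside the `GSp₄/ℚ` sector;
* `phantomRMJunction_globalDebt`: junction + target give BOTH directions of reciprocity for every
  `GL_n`, `n ≥ 1`, over every number field, with local–global compatibility at every finite place —
  of which the sector's conclusion (a.e. Satake matching for one `ρ` on `GL₄/ℚ`) is a shadow of the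
  `n = 4`, `F = ℚ` instance of (B).

Mechanical repair 2026-08-17 (statement re-type D-0032 §4c, p141787: the summit is now
`∀ F, Nonempty (ReciprocityData F) ∧ ∀ 𝓡 n, 0 < n → ∀ hcpt, …` instead of `∀ F, ∃ 𝓡, …`): the two
`…Debt` proofs open the summit by `obtain ⟨⟨𝓡⟩, hall⟩ := hJ hX F` (a datum from the `Nonempty`
conjunct, the clause from the `∀ 𝓡` conjunct); every statement of this file is unchanged — the
`∃ 𝓡`-shaped `phantomRMJunction_globalDebt` is now the shadow, at one datum, of what junction +
target give for EVERY Henniart-normalised, Artin-pinned reciprocity datum.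
-/

set_option linter.dupNamespace false -- project-wide option; `Summit.Langlands.Langlands` is the mandated namespace

namespace Summit.Langlands.Langlands.Theorems

open Summit.Langlands.Langlands.Theses.PhantomRMYoshida

/-- The re-issued spelling `∀ _ : PhantomRMSector, Langlands` is definitionally the arrow
`PhantomRMSector → Langlands`. [folklore] -/
theorem phantomRMJunction_iff_imp : PhantomRMJunction ↔ (PhantomRMSector → _root_.Langlands) :=
  Iff.rfl

/-- Truth table of the junction: `PhantomRMJunction ↔ ¬ PhantomRMSector ∨ Langlands`. In
particular `Langlands → PhantomRMJunction` (discard the sector) and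
`¬ PhantomRMSector → PhantomRMJunction` (ex falso) are its two cheap directions, and there is no
third: the item is provable only by proving the summit or by refuting the route target.
[folklore] -/
theorem phantomRMJunction_iff_not_or :
    PhantomRMJunction ↔ ¬ PhantomRMSector ∨ _root_.Langlands :=
  imp_iff_not_or

/-- Under the route TARGET `PhantomRMSector`, the junction is literally the summit:
`PhantomRMJunction ↔ Langlands`. [folklore] -/
theorem phantomRMJunction_iff_of_target (hX : PhantomRMSector) :
    PhantomRMJunction ↔ _root_.Langlands :=
  ⟨fun hJ ↦ hJ hX, fun h _ ↦ h⟩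

/-- Under the other three hypotheses of the deciding theorem — `SerreKWAutomorphicGL2`,
`StableYoshidaCongruence`, `ResiduallyYoshidaLifting` — the junction is equivalent to the summit:
`PhantomRMJunction ↔ Langlands` (`→` is the route's sorry-free `closes`). So this item can close
only together with the summit once the route's cruxes land. [folklore] -/
theorem phantomRMJunction_iff_of_cruxes (hKW : SerreKWAutomorphicGL2) (hS : StableYoshidaCongruence)
    (hL : ResiduallyYoshidaLifting) : PhantomRMJunction ↔ _root_.Langlands :=
  ⟨fun hJ ↦ closes hKW hS hL hJ, fun h _ ↦ h⟩

/-- The exact content of a refutation of the junction: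
`¬ PhantomRMJunction ↔ PhantomRMSector ∧ ¬ Langlands` — prove the open sector AND disprove the
formal summit; in particular any refutation of the item is a disproof of `_root_.Langlands`.
[folklore] -/
theorem not_phantomRMJunction_iff :
    ¬ PhantomRMJunction ↔ PhantomRMSector ∧ ¬ _root_.Langlands :=
  Classical.not_imp

/-- The junction carries the summit's Statement debt at the local level: together with the route
target it yields, for EVERY number field `F` and EVERY finite place `v`, a local Langlands datum for
the general linear groups over `F_v` (the `llc` field of the reciprocity data `𝓡` that `Langlands`
asserts to exist) — Harris–Taylor/Henniart content (named fact `LocalLanglandsDatum.nonempty`), far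
outside the `GSp₄/ℚ` sector. [folklore] -/
theorem phantomRMJunction_localLanglandsDebt (hJ : PhantomRMJunction) (hX : PhantomRMSector)
    (F : Type) [Field F] [NumberField F]
    (v : IsDedekindDomain.HeightOneSpectrum (NumberField.RingOfIntegers F)) :
    Nonempty (Literature.NumberTheory.Automorphic.LocalLanglandsDatum (v.adicCompletion F)) := by
  obtain ⟨⟨𝓡⟩, -⟩ := hJ hX F
  exact ⟨𝓡.llc v⟩

/-- The junction carries the summit's global content: together with the route target it yields,
for every number field `F`, reciprocity data `𝓡` with BOTH directions (A) `AutomorphicToGalois n`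
and (B) `GaloisToAutomorphic n` for every `n ≥ 1` and every level-compactness witness, with
local–global compatibility at every finite place (`Corresponds`) — the sector's own conclusion
(a.e. Satake matching for one symplectic `ρ` on `GL₄/ℚ`) is a shadow of the `n = 4`, `F = ℚ`
instance of (B). [folklore] -/
theorem phantomRMJunction_globalDebt (hJ : PhantomRMJunction) (hX : PhantomRMSector)
    (F : Type) [Field F] [NumberField F] :
    ∃ 𝓡 : Summit.Langlands.ReciprocityData F, ∀ n : ℕ, 0 < n →
      ∀ hcpt : Literature.NumberTheory.Automorphic.isCompact_glFiniteIntegralLevel n F,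
        Summit.Langlands.AutomorphicToGalois n 𝓡 hcpt ∧
          Summit.Langlands.GaloisToAutomorphic n 𝓡 hcpt := by
  obtain ⟨⟨𝓡⟩, hall⟩ := hJ hX F
  exact ⟨𝓡, hall 𝓡⟩

end Summit.Langlands.Langlands.Theorems
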